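import Literature.NumberTheory.LFunctions.RayClassCharacter
import Literature.NumberTheory.QuadraticForms.NormModFour
import Mathlib.NumberTheory.DirichletCharacter.Bounds
import Mathlib.NumberTheory.NumberField.Completion.FinitePlace
import Mathlib.RingTheory.Norm.Basic
import HarnessLib

/-!
# The ray class characters `ψ ∘ N_{K/ℚ}` attached to Dirichlet characters `ψ mod m`

Topic `Literature/NumberTheory/LFunctions`; companion of `RayClassCharacter.lean`
(`IsRayClassCharacter 𝔪 ψ`, `idealPow`, `rayClassLSeries`).  Everything here is PROVED; the only
new definition is `Literature.NumberTheory.LFunctions.normCharValue ψ v = ψ(N(v) mod m)`, the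
values on primes of the character `𝔞 ↦ ψ(N_{K/ℚ}(𝔞) mod m)` of the group of ideals of `K` prime to
`m`, for a Dirichlet character `ψ mod m` (Mathlib `DirichletCharacter ℂ m`).  These are the
"Dirichlet characters factoring through the norm" of the cyclotomic extension `K(ζ_m)/K` (Tate,
*Global class field theory*, Ch. VII of Cassels–Fröhlich, §3: Prop. 3.2, `F_{L'/K'} = F_{L/K} ∘ N_{K'/K}`,
and §3.4, the reciprocity law for `ℚ(ζ_m)/ℚ`, `F((a))ζ = ζ^a`), whose `L`-series
`L_K(s, ψ ∘ N)` drive Dirichlet's theorem for `K(ζ_m)/K` (planned,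
`GaloisRepresentations/CyclotomicChebotarevProofs.lean`).

Main results:

* `Literature.NumberTheory.LFunctions.norm_pos_of_totallyPositive` — a totally positive
  nonzero `x ∈ K` has `N_{K/ℚ}(x) > 0`, a corollary of the sign formula
  `Literature.NumberTheory.QuadraticForms.norm_pos_iff_even_ncard` of
  `QuadraticForms/NormModFour.lean` (O'Meara 71:11; Mathlib's
  `NumberField.InfinitePlace.prod_eq_abs_norm` only gives `|N(x)|`).
* `Literature.NumberTheory.LFunctions.intCast_norm_eq_of_sub_mem_span` — `b ≡ c (mod m 𝓞_K)`
  implies `N(b) ≡ N(c) (mod m)` (determinants of congruent multiplication matrices);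
  `natCast_absNorm_span_singleton_eq` — hence `N((b)) ≡ N((c)) (mod m)` when moreover `b c` is
  totally positive (same sign).
* `isUnit_natCast_absNorm_iff` — `N(v) = p^f` for the prime `p ∈ v` (Mathlib
  `Ideal.exists_prime_and_absNorm_eq_pow`), so `N(v) mod m` is a unit iff `m ∉ v`.
* `Literature.NumberTheory.LFunctions.isRayClassCharacter_normCharValue` — **`ψ ∘ N` is a ray
  class character `mod (m)`** in the sense of `IsRayClassCharacter` (narrow ray classes), with
  `idealPow_normCharValue : χ(𝔞) = ψ(N(𝔞) mod m)` on nonzero ideals.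

## References

* J. Tate, *Global class field theory*, Ch. VII of Cassels–Fröhlich (1967), §3.2, §3.4.
  [TateGCFT1967]
* H. Heilbronn, *Zeta-functions and L-functions*, ibid., Ch. VIII, §1 (Dirichlet characters
  `mod 𝔪`). [HeilbronnZetaL1967]
* J. Neukirch, *Algebraic Number Theory* (1999), VII (6.8). [NeukirchANT1999]
-/

noncomputable section

open NumberField IsDedekindDomain Finset

namespace Literature.NumberTheory.LFunctions

variable {K : Type*} [Field K] [NumberField K]

/-! ### Totally positive elements have positive norm -/

/-- **A totally positive nonzero element of a number field has positive norm**: by the sign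
formula `N_{K/ℚ}(x) > 0 ⇔ #{w real : σ_w(x) < 0}` even (the tree's
`Literature.NumberTheory.QuadraticForms.norm_pos_iff_even_ncard`, `QuadraticForms/NormModFour.lean`,
O'Meara 71:11), the set of real places where `x` is negative being empty. [folklore] -/
theorem norm_pos_of_totallyPositive {x : K} (hx0 : x ≠ 0) (hx : ∀ φ : K →+* ℝ, 0 < φ x) :
    0 < Algebra.norm ℚ x := by
  rw [QuadraticForms.norm_pos_iff_even_ncard hx0]
  have hempty : {w : InfinitePlace K | ∃ hw : w.IsReal,
      InfinitePlace.embedding_of_isReal hw x < 0} = ∅ := by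
    ext w
    simp only [Set.mem_setOf_eq, Set.mem_empty_iff_false, iff_false, not_exists, not_lt]
    intro hw
    exact (hx _).le
  rw [hempty, Set.ncard_empty]
  exact Even.zero

/-! ### Norms are congruent modulo `m` for elements congruent modulo `m` -/

/-- If `b ≡ c (mod m 𝓞_K)` then `N_{K/ℚ}(b) ≡ N_{K/ℚ}(c) (mod m)`: the norm is the determinant
of the multiplication matrix in an integral basis, and the two matrices are congruent entrywise.
[folklore] -/
theorem intCast_norm_eq_of_sub_mem_span {m : ℕ} {b c : 𝓞 K}
    (h : b - c ∈ Ideal.span {((m : ℕ) : 𝓞 K)}) :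
    ((Algebra.norm ℤ b : ℤ) : ZMod m) = ((Algebra.norm ℤ c : ℤ) : ZMod m) := by
  classical
  obtain ⟨d, hd⟩ := Ideal.mem_span_singleton'.mp h
  set bs := RingOfIntegers.basis K
  set f := Int.castRingHom (ZMod m) with hf
  have e : ∀ y : 𝓞 K, ((Algebra.norm ℤ y : ℤ) : ZMod m) =
      (f.mapMatrix (Algebra.leftMulMatrix bs y)).det := fun y => by
    rw [Algebra.norm_eq_matrix_det bs y, ← RingHom.map_det, hf, Int.coe_castRingHom]
  have hb : b = c + d * (m : 𝓞 K) := by rw [hd]; ring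
  have hzero : f.mapMatrix (Algebra.leftMulMatrix bs ((m : ℕ) : 𝓞 K)) = 0 := by
    rw [map_natCast, map_natCast, ← nsmul_one, ← Nat.cast_smul_eq_nsmul (ZMod m),
      ZMod.natCast_self, zero_smul]
  rw [e, e, hb, map_add, map_mul, map_add, map_mul, hzero, mul_zero, add_zero]

/-- **The absolute norms of narrowly congruent generators agree modulo `m`**: for nonzero
`b, c ∈ 𝓞_K` with `b ≡ c (mod m)` and `b c` totally positive, `N((b)) ≡ N((c)) (mod m)`
(`N((b)) = |N(b)|`; the norms are congruent and have the same sign since `N(bc) > 0`).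
[folklore] -/
theorem natCast_absNorm_span_singleton_eq {m : ℕ} {b c : 𝓞 K} (hb : b ≠ 0) (hc : c ≠ 0)
    (h : b - c ∈ Ideal.span {((m : ℕ) : 𝓞 K)}) (hpos : ∀ φ : K →+* ℝ, 0 < φ b * φ c) :
    ((Ideal.absNorm (Ideal.span {b}) : ℕ) : ZMod m) =
      ((Ideal.absNorm (Ideal.span {c}) : ℕ) : ZMod m) := by
  have hcong := intCast_norm_eq_of_sub_mem_span h
  -- the norms have the same sign: `N(b) N(c) = N(bc) > 0`
  have hprod : 0 < Algebra.norm ℤ b * Algebra.norm ℤ c := by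
    have h1 : 0 < Algebra.norm ℚ (((b * c : 𝓞 K)) : K) := by
      have hbc : (((b * c : 𝓞 K)) : K) = (b : K) * (c : K) := rfl
      rw [hbc]
      refine norm_pos_of_totallyPositive (mul_ne_zero ?_ ?_) fun φ => ?_
      · exact RingOfIntegers.coe_ne_zero_iff.mpr hb
      · exact RingOfIntegers.coe_ne_zero_iff.mpr hc
      · rw [map_mul]; exact hpos φ
    rw [← Algebra.coe_norm_int, map_mul] at h1
    exact_mod_cast h1
  rw [Ideal.absNorm_span_singleton, Ideal.absNorm_span_singleton, ← Int.cast_natCast,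
    ← Int.cast_natCast (R := ZMod m) (Algebra.norm ℤ c).natAbs]
  rcases pos_and_pos_or_neg_and_neg_of_mul_pos hprod with ⟨hb', hc'⟩ | ⟨hb', hc'⟩
  · rw [Int.natAbs_of_nonneg hb'.le, Int.natAbs_of_nonneg hc'.le, hcong]
  · rw [Int.ofNat_natAbs_of_nonpos hb'.le, Int.ofNat_natAbs_of_nonpos hc'.le, Int.cast_neg,
      Int.cast_neg, hcong]

/-! ### The prime below a nonzero prime and coprimality of norms to `m` -/

/-- If `m ∉ v` then `N(v)` is prime to `m`. [folklore] -/
theorem coprime_absNorm_of_natCast_not_mem {m : ℕ} (v : HeightOneSpectrum (𝓞 K))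
    (hm : (m : 𝓞 K) ∉ v.asIdeal) : Nat.Coprime (Ideal.absNorm v.asIdeal) m := by
  haveI := v.isMaximal
  obtain ⟨p, n, -, hpv, hp, hN⟩ := Ideal.exists_prime_and_absNorm_eq_pow v.asIdeal
  rw [hN]
  refine Nat.Coprime.pow_left n ?_
  rw [Nat.Prime.coprime_iff_not_dvd hp]
  rintro ⟨k, rfl⟩
  apply hm
  rw [Nat.cast_mul]
  exact v.asIdeal.mul_mem_right _ hpv

/-- If `m ∈ v` then `N(v)` is not prime to `m` (the prime `p` below `v` divides both).
[folklore] -/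
theorem not_coprime_absNorm_of_natCast_mem {m : ℕ} (v : HeightOneSpectrum (𝓞 K))
    (hm : (m : 𝓞 K) ∈ v.asIdeal) : ¬ Nat.Coprime (Ideal.absNorm v.asIdeal) m := by
  haveI := v.isMaximal
  obtain ⟨p, n, hn0, hpv, hp, hN⟩ := Ideal.exists_prime_and_absNorm_eq_pow v.asIdeal
  have hpm : p ∣ m := by
    by_contra hnd
    have hcop : IsCoprime (p : ℤ) (m : ℤ) :=
      Nat.isCoprime_iff_coprime.mpr ((Nat.Prime.coprime_iff_not_dvd hp).mpr hnd)
    obtain ⟨a, b, hab⟩ := hcop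
    apply v.isPrime.ne_top
    rw [Ideal.eq_top_iff_one]
    have h1 : ((a * p + b * m : ℤ) : 𝓞 K) = 1 := by rw [hab, Int.cast_one]
    rw [← h1]
    push_cast
    exact v.asIdeal.add_mem (v.asIdeal.mul_mem_left _ hpv) (v.asIdeal.mul_mem_left _ hm)
  rw [hN]
  intro hcop
  exact (Nat.Prime.coprime_iff_not_dvd hp).mp ((Nat.coprime_pow_left_iff hn0 _ _).mp hcop) hpm

/-- `m ∉ v` iff the residue of `N(v)` modulo `m` is a unit. [folklore] -/
theorem isUnit_natCast_absNorm_iff {m : ℕ} (v : HeightOneSpectrum (𝓞 K)) :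
    IsUnit ((Ideal.absNorm v.asIdeal : ℕ) : ZMod m) ↔ (m : 𝓞 K) ∉ v.asIdeal := by
  rw [ZMod.isUnit_iff_coprime]
  exact ⟨fun h hm => not_coprime_absNorm_of_natCast_mem v hm h,
    coprime_absNorm_of_natCast_not_mem v⟩

omit [NumberField K] in
/-- `(m) ⊆ v` iff `m ∈ v`. [folklore] -/
theorem span_natCast_le_iff {m : ℕ} (v : HeightOneSpectrum (𝓞 K)) :
    Ideal.span {((m : ℕ) : 𝓞 K)} ≤ v.asIdeal ↔ (m : 𝓞 K) ∈ v.asIdeal :=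
  Ideal.span_singleton_le_iff_mem _

/-! ### The characters `ψ ∘ N` -/

/-- The values on primes of the character `𝔞 ↦ ψ(N(𝔞) mod m)` of the group of ideals prime to
`m`, for a Dirichlet character `ψ mod m`: `v ↦ ψ(N(v) mod m)` (`= 0` when `m ∈ v`). [folklore] -/
def normCharValue {m : ℕ} (ψ : DirichletCharacter ℂ m) (v : HeightOneSpectrum (𝓞 K)) : ℂ :=
  ψ ((Ideal.absNorm v.asIdeal : ℕ) : ZMod m)

/-- Unfolding lemma for `normCharValue`. [folklore] -/
theorem normCharValue_apply {m : ℕ} (ψ : DirichletCharacter ℂ m) (v : HeightOneSpectrum (𝓞 K)) :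
    normCharValue ψ v = ψ ((Ideal.absNorm v.asIdeal : ℕ) : ZMod m) := rfl

/-- On every nonzero ideal the character with prime values `normCharValue ψ` is `ψ(N(𝔞) mod m)`
(multiplicativity of `N` and of `ψ`). [folklore] -/
theorem idealPow_normCharValue {m : ℕ} (ψ : DirichletCharacter ℂ m) {I : Ideal (𝓞 K)}
    (hI : I ≠ ⊥) : idealPow K (normCharValue ψ) I = ψ ((Ideal.absNorm I : ℕ) : ZMod m) := by
  obtain ⟨g, rfl⟩ := (mem_range_finsuppProd_asIdeal_pow_iff (I := I)).mpr hI
  rw [idealPow_finsuppProd, map_finsuppProd Ideal.absNorm, Nat.cast_finsuppProd,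
    map_finsuppProd ψ]
  simp only [normCharValue, map_pow, Nat.cast_pow]

/-- `normCharValue ψ v = 0` at the primes `v ∋ m`. [folklore] -/
theorem normCharValue_eq_zero_of_mem {m : ℕ} (ψ : DirichletCharacter ℂ m)
    {v : HeightOneSpectrum (𝓞 K)} (hv : (m : 𝓞 K) ∈ v.asIdeal) : normCharValue ψ v = 0 :=
  ψ.map_nonunit fun h => (isUnit_natCast_absNorm_iff v).mp h hv

/-- `|normCharValue ψ v| = 1` at the primes `v ∌ m`. [folklore] -/
theorem norm_normCharValue_of_not_mem {m : ℕ} (ψ : DirichletCharacter ℂ m)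
    {v : HeightOneSpectrum (𝓞 K)} (hv : (m : 𝓞 K) ∉ v.asIdeal) : ‖normCharValue ψ v‖ = 1 := by
  obtain ⟨u, hu⟩ := (isUnit_natCast_absNorm_iff v).mpr hv
  rw [normCharValue, ← hu]
  exact ψ.unit_norm_eq_one u

/-- **`ψ ∘ N` is a ray class character `mod (m)`** (narrow ray classes): its values on the primes
`v ∤ m` lie on the unit circle, and for nonzero `b ≡ c (mod m)` with `c` prime to `m` and `b/c`
totally positive one has `ψ(N((b))) = ψ(N((c)))` (`natCast_absNorm_span_singleton_eq`).  (Cf.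
Tate, *Global class field theory*, Ch. VII of Cassels–Fröhlich, §3, Prop. 3.2 and §3.4: the
reciprocity map of the cyclotomic extension factors through the norm.) [folklore] -/
theorem isRayClassCharacter_normCharValue {m : ℕ} (ψ : DirichletCharacter ℂ m) :
    IsRayClassCharacter (Ideal.span {((m : ℕ) : 𝓞 K)}) (normCharValue (K := K) ψ) where
  norm_eq_one v hv :=
    norm_normCharValue_of_not_mem ψ fun h => hv ((span_natCast_le_iff v).mpr h)
  idealPow_span_eq b c hb hc _ hbc hpos := by
    rw [idealPow_normCharValue ψ (by rwa [Ne, Ideal.span_singleton_eq_bot]),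
      idealPow_normCharValue ψ (by rwa [Ne, Ideal.span_singleton_eq_bot]),
      natCast_absNorm_span_singleton_eq hb hc hbc hpos]

end Literature.NumberTheory.LFunctions
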